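import Literature.AnabelianGeometry.EtaleTheta.BiKummerThm44SubModelConnectedBaseInj
import Literature.AnabelianGeometry.EtaleTheta.Discharge.Sec3Thm37Holds
import Literature.AnabelianGeometry.EtaleTheta.Discharge.Sec3Thm37UnitProfinite
import Literature.AnabelianGeometry.EtaleTheta.Discharge.Sec3Thm37Units
import Literature.AnabelianGeometry.SemiGraphs.CosetCategoriesSlimTempered
import HarnessLib

/-!
# [EtTh] Theorem 3.7 (iv) «`D` slim, `Λ ∈ {ℤ, ℝ}` ⟹ `C` slim» at the GENUINE base `D = B^temp(Π)⁰` with the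
# structural binder `hBinj` in BASE-IMAGE form (proof-only)

S. Mochizuki, *The étale theta function and its Frobenioid-theoretic manifestations*, Publ. RIMS **45** (2009)
[MochizukiEtTh2009], Thm. 3.7 (iv), printed p. 306 (PDF p. 80); Rmk. 3.7.2; Def. 3.3 (iii) PDF p. 73; Def. 3.6 (i)(ii)
PDF pp. 76–77.  abc-iut cell, layer L2, cone node **EtTh:Thm3.7(iv)** (`N_EtTh_Thm3_7_iv`).  Seat abc-iut-w5-d179 (gen 4),
by-name sibling of abc-iut-w6-d048's `Discharge/Sec3Thm37ivGenuineBase.lean` (p432030).  PROOF-ONLY (0 `def`s, no `Prop`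
facts, no instances); nothing landed is edited or restated.

WHY.  p432030 proves, at the genuine base `ConnectedPart (BTemp Π)`, «`C` is slim» (the conclusion of Thm. 3.7 (iv)) modulo
{`hBinj`, `hdiv`} (resp. `hBinj` alone for the constructed `Λ = ℝ` data `ofRlfR`, {`hBinj`, `hP34`} for `ofRlfZ`), where

  `hBinj : ∀ {Y Y' : D₀ᵒᵖ} (g : Y ⟶ Y'), Injective (T.BΛ.map g).hom`

quantifies over ALL morphisms of the abstract Def. 3.3 (iii) base `D₀`.  Print's `D₀ = B^temp(X^log)⁰` has CONNECTED objects
only (every transition map of `B₀(Y) = lim Mero(Z_∞)^{Gal(Z_∞/Y)}` is then an inclusion of invariants); a typed `D₀` with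
non-connected objects — e.g. the category `Action (Type u) G` of ALL `G`-sets carrying abc-iut-w6-d058's genuine
Def. 3.3 (iii) record `DivisorMonoids.ofGaloisAction` (p436163 and sequel: `bZeroPull_injective` holds along SURJECTIVE
covering maps) — makes `hBinj` as quantified FALSE (`B₀(∅) = 1`).  The proofs use `hBinj` only along `tf.base.map α`
for `α` in `D` (abc-iut-L2-t3's `ratFnPull_injective`); `BiKummerThm44SubModelConnectedBaseInj.lean` (this seat, p436787)
re-keyed «`B` a monoid on `D`» / «`C` a Frobenioid» on that BASE-IMAGE form

  `hBD : ∀ {A B : D} (α : B ⟶ A), Injective (T.BΛ.map (C₀.base.map α).op).hom`.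

THIS FILE does the same for the EtTh:Thm3.7(iv) closers of p432030 (one-line re-compositions over abc-iut-L2-t3 /
abc-iut-L1-t1 / abc-iut-L6-t13's hF-level API `isSlim_category_of_isFrobenioid`, `…_of_kerIsoPadicUnits`,
`…_of_divΛ_injective`, `thm37_iv_treeCatVocab_of_isMonoidOn`, `thm37_iv_ofRlfR_treeCatVocab`):
* `thm37_iv_connectedPart_of_baseInj`, `isSlim_category_connectedPart_of_baseInj` (+ `…_of_kerIsoPadicUnits`,
  `…_of_divΛ_injective`), `isSlim_category_of_temperedArithmeticGroup_of_baseInj`;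
* `isSlim_category_ofRlfR_connectedPart_of_baseInj` — **`Λ = ℝ`: «`C` slim» ⇐ `hBD` ALONE**;
* `isOfUnitProfiniteType_and_isSlim_ofRlfZ_connectedPart_of_baseInj` — **`Λ = ℤ`: ⇐ {`hBD`, `hP34`}**.
HONEST FRAMING: refereed pre-IUT material; every theorem is an implication for data so parametrised; nothing here bears on
the disputed [IUTchIII] Cor. 3.12; typed ≠ proved — here PROVED.
-/

namespace Literature.AnabelianGeometry.EtaleTheta

open CategoryTheory Opposite Function Literature.AlgebraicGeometry.Frobenioids Literature.AnabelianGeometry.SemiGraphs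

namespace TemperedFrobenioid

universe u₀ v₀ u v w uK

/-! ### §1 The genuine base `D = B^temp(Π)⁰` -/

section ConnectedTemperoid

variable {G : Type u} [Group G] [TopologicalSpace G] {D₀ : Type u₀} [Category.{v₀} D₀] {V : FrdIMonoidStub.{w}}
  {T : RealifiedDivisorMonoids (D₀ := D₀) V}
  {IsRational IsStrictlyRational : ((ConnectedPart (BTemp G))ᵒᵖ ⥤ CommMonCat.{w}) → Prop}
  (C₀ : TemperedFrobenioid T (ConnectedPart (BTemp G))
    (treeCatVocab (ConnectedPart (BTemp G)) IsRational IsStrictlyRational))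

/-- **Thm. 3.7 (iv)** (abc-iut-L2-t3's named `Prop` `Thm37_iv`) at the genuine base `B^temp(Π)⁰`, modulo the base-image
binder `hBD` and `hdiv`. [cite: MochizukiEtTh2009, Thm 3.7 p.80] -/
theorem thm37_iv_connectedPart_of_baseInj
    (hBD : ∀ {A B : ConnectedPart (BTemp G)} (α : B ⟶ A), Injective (T.BΛ.map (C₀.base.map α).op).hom)
    (hdiv : ∀ (X : C₀.category) (α : Aut X), α ∈ PreFrobenioid.unitsSubgroup C₀.toElem X →
      (∀ n : ℕ+, ∃ β : Aut X, β ∈ PreFrobenioid.unitsSubgroup C₀.toElem X ∧ β ^ (n : ℕ) = α) → α = 1) :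
    C₀.Thm37_iv :=
  C₀.thm37_iv_treeCatVocab_of_isMonoidOn (C₀.isMonoidOn_ratFnFunctor_connectedPart_of_baseInj hBD) hdiv

variable [IsTopologicalGroup G] {p : ℕ} [Fact p.Prime]

/-- **The CONCLUSION of Thm. 3.7 (iv) at the genuine base `B^temp(Π)⁰` of a tempered, temp-slim group `Π`**: «`C` is
slim» modulo the base-image binder `hBD` and `hdiv` («`D` slim» = [SemiAnbd] Rmk. 3.4.1 / Ex. 3.10
`isSlim_connectedPart_bTemp`). [cite: MochizukiEtTh2009, Thm 3.7 p.80] -/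
theorem isSlim_category_connectedPart_of_baseInj (hG : IsTempered G) (hZ : IsSlimGroup G)
    (hBD : ∀ {A B : ConnectedPart (BTemp G)} (α : B ⟶ A), Injective (T.BΛ.map (C₀.base.map α).op).hom)
    (hdiv : ∀ (X : C₀.category) (α : Aut X), α ∈ PreFrobenioid.unitsSubgroup C₀.toElem X →
      (∀ n : ℕ+, ∃ β : Aut X, β ∈ PreFrobenioid.unitsSubgroup C₀.toElem X ∧ β ^ (n : ℕ) = α) → α = 1) :
    IsSlim C₀.category :=
  C₀.isSlim_category_of_isFrobenioid (C₀.isFrobenioid_connectedPart_of_baseInj hBD) hdiv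
    (isSlim_connectedPart_bTemp hG hZ)

/-- Same, **case `Λ = ℤ` of print's proof**: «`C` is slim» modulo `hBD` and the Prop. 3.4 (ii) isomorphisms `hP34`.
[cite: MochizukiEtTh2009, Thm 3.7 p.80] -/
theorem isSlim_category_connectedPart_of_baseInj_of_kerIsoPadicUnits (hG : IsTempered G) (hZ : IsSlimGroup G)
    (hBD : ∀ {A B : ConnectedPart (BTemp G)} (α : B ⟶ A), Injective (T.BΛ.map (C₀.base.map α).op).hom)
    (hP34 : ∀ A : (ConnectedPart (BTemp G))ᵒᵖ, ∃ L : PadicFrd.PadicFld.{uK} p, L.IsPadicLocal ∧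
      Nonempty (((T.divΛ (C₀.baseOp A)).comp (Units.coeHom (T.BΛ.obj (C₀.baseOp A)))).ker ≃*
        PadicFrd.unitSubgroup L.K)) :
    IsSlim C₀.category :=
  C₀.isSlim_category_of_kerIsoPadicUnits (C₀.isFrobenioid_connectedPart_of_baseInj hBD) hP34
    (isSlim_connectedPart_bTemp hG hZ)

/-- Same, **case `Λ = ℝ` of print's proof**: «`C` is slim» modulo `hBD` and the injectivity `hinj` of
`B₀^Λ → (Φ₀^ℝ)^gp`. [cite: MochizukiEtTh2009, Thm 3.7 p.80] -/
theorem isSlim_category_connectedPart_of_baseInj_of_divΛ_injective (hG : IsTempered G) (hZ : IsSlimGroup G)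
    (hBD : ∀ {A B : ConnectedPart (BTemp G)} (α : B ⟶ A), Injective (T.BΛ.map (C₀.base.map α).op).hom)
    (hinj : ∀ A : (ConnectedPart (BTemp G))ᵒᵖ, Injective (T.divΛ (C₀.baseOp A))) : IsSlim C₀.category :=
  C₀.isSlim_category_of_divΛ_injective (C₀.isFrobenioid_connectedPart_of_baseInj hBD) hinj
    (isSlim_connectedPart_bTemp hG hZ)

end ConnectedTemperoid

/-! ### §2 The base of [EtTh] §3–§5 as printed: `D₀ = B^temp(Π^tp_X)⁰` for a tempered arithmetic fundamental group -/

section TemperedArithmeticGroup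

variable {K : Type u} [Field K] (X : TemperedArithmeticGroup.{u} K) {D₀ : Type u₀} [Category.{v₀} D₀]
  {V : FrdIMonoidStub.{w}} {T : RealifiedDivisorMonoids (D₀ := D₀) V}
  {IsRational IsStrictlyRational : ((ConnectedPart (BTemp X.Pi))ᵒᵖ ⥤ CommMonCat.{w}) → Prop}
  (C₀ : TemperedFrobenioid T (ConnectedPart (BTemp X.Pi))
    (treeCatVocab (ConnectedPart (BTemp X.Pi)) IsRational IsStrictlyRational))

/-- **Thm. 3.7 (iv) as printed, conclusion «`C` is slim», at `D = B^temp(Π^tp_X)⁰`**, modulo the base-image binder `hBD`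
and `hdiv`. [cite: MochizukiEtTh2009, Thm 3.7 p.80] -/
theorem isSlim_category_of_temperedArithmeticGroup_of_baseInj
    (hBD : ∀ {A B : ConnectedPart (BTemp X.Pi)} (α : B ⟶ A), Injective (T.BΛ.map (C₀.base.map α).op).hom)
    (hdiv : ∀ (Y : C₀.category) (α : Aut Y), α ∈ PreFrobenioid.unitsSubgroup C₀.toElem Y →
      (∀ n : ℕ+, ∃ β : Aut Y, β ∈ PreFrobenioid.unitsSubgroup C₀.toElem Y ∧ β ^ (n : ℕ) = α) → α = 1) :
    IsSlim C₀.category :=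
  C₀.isSlim_category_of_isFrobenioid (C₀.isFrobenioid_connectedPart_of_baseInj hBD) hdiv X.isSlim_connectedPart

end TemperedArithmeticGroup

/-! ### §3 `Λ = ℝ`: the constructed data `ofRlfR dm hpf` over the genuine base — «`C` slim» modulo `hBD` ALONE -/

section OfRlfR

variable {G : Type u} [Group G] [TopologicalSpace G] [IsTopologicalGroup G] {D₀ : Type u₀} [Category.{v₀} D₀]
  (dm : DivisorMonoids.{u₀, v₀, w} D₀) (hpf : ∀ Y : D₀ᵒᵖ, IsPerfFactorial (dm.Φ₀.obj Y))
  {IsRational IsStrictlyRational : ((ConnectedPart (BTemp G))ᵒᵖ ⥤ CommMonCat.{w}) → Prop}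
  (C₀ : TemperedFrobenioid (RealifiedDivisorMonoids.ofRlfR dm hpf) (ConnectedPart (BTemp G))
    (treeCatVocab (ConnectedPart (BTemp G)) IsRational IsStrictlyRational))

/-- **Thm. 3.7 (iv) for monoid type `ℝ` at the genuine base, conclusion «`C` is slim», modulo `hBD` ALONE**
(`Π` tempered and temp-slim). [cite: MochizukiEtTh2009, Thm 3.7 p.80] -/
theorem isSlim_category_ofRlfR_connectedPart_of_baseInj (hG : IsTempered G) (hZ : IsSlimGroup G)
    (hBD : ∀ {A B : ConnectedPart (BTemp G)} (α : B ⟶ A),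
      Injective ((RealifiedDivisorMonoids.ofRlfR dm hpf).BΛ.map (C₀.base.map α).op).hom) :
    IsSlim C₀.category :=
  C₀.thm37_iv_ofRlfR_treeCatVocab dm hpf (C₀.isMonoidOn_ratFnFunctor_connectedPart_of_baseInj hBD)
    (isSlim_connectedPart_bTemp hG hZ) (Or.inr (C₀.monoidType_ofRlfR dm hpf))

end OfRlfR

/-! ### §4 `Λ = ℤ`: the constructed data `ofRlfZ dm hpf` over the genuine base — «`C` slim» modulo `hBD` + `hP34` -/

section OfRlfZ

variable {G : Type u} [Group G] [TopologicalSpace G] [IsTopologicalGroup G] {D₀ : Type u₀} [Category.{v₀} D₀]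
  (dm : DivisorMonoids.{u₀, v₀, w} D₀) (hpf : ∀ Y : D₀ᵒᵖ, IsPerfFactorial (dm.Φ₀.obj Y))
  {IsRational IsStrictlyRational : ((ConnectedPart (BTemp G))ᵒᵖ ⥤ CommMonCat.{w}) → Prop}
  (C₁ : TemperedFrobenioid (RealifiedDivisorMonoids.ofRlfZ dm hpf) (ConnectedPart (BTemp G))
    (treeCatVocab (ConnectedPart (BTemp G)) IsRational IsStrictlyRational)) {p : ℕ} [Fact p.Prime]

/-- **Thm. 3.7 (i) «unit-profinite type» ∧ (iv) «`C` slim» for monoid type `ℤ` at the genuine base**, modulo `hBD`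
(= «`B₀(Y) ↪ B₀(Y′)` along the coverings used», `ofRlfZ_BΛ`) and the Prop. 3.4 (ii) isomorphisms `hP34`.
[cite: MochizukiEtTh2009, Thm 3.7 p.80] -/
theorem isOfUnitProfiniteType_and_isSlim_ofRlfZ_connectedPart_of_baseInj (hG : IsTempered G) (hZ : IsSlimGroup G)
    (hBD : ∀ {A B : ConnectedPart (BTemp G)} (α : B ⟶ A),
      Injective ((RealifiedDivisorMonoids.ofRlfZ dm hpf).BΛ.map (C₁.base.map α).op).hom)
    (hP34 : ∀ A : (ConnectedPart (BTemp G))ᵒᵖ, ∃ L : PadicFrd.PadicFld.{uK} p, L.IsPadicLocal ∧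
      Nonempty ((((RealifiedDivisorMonoids.ofRlfZ dm hpf).divΛ (C₁.baseOp A)).comp
        (Units.coeHom ((RealifiedDivisorMonoids.ofRlfZ dm hpf).BΛ.obj (C₁.baseOp A)))).ker ≃*
        PadicFrd.unitSubgroup L.K)) :
    PreFrobenioid.IsOfUnitProfiniteType C₁.toElem ∧ IsSlim C₁.category :=
  have hF := C₁.isFrobenioid_connectedPart_of_baseInj hBD
  ⟨C₁.isOfUnitProfiniteType_of_kerIsoPadicUnits hF hP34,
    C₁.isSlim_category_of_kerIsoPadicUnits hF hP34 (isSlim_connectedPart_bTemp hG hZ)⟩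

end OfRlfZ

end TemperedFrobenioid

end Literature.AnabelianGeometry.EtaleTheta
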